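import Mathlib
import Summits.RiemannHypothesis.RiemannHypothesis.Theorems.JensenPolynomialsDefs
import Literature.NumberTheory.LFunctions.XiMoments

/-! # JensenWindowEnergy — S-H3, the double-root WINDOW rows: the normalised downward three-term recurrence at a critical
point `y` of `H_{d−1}(X/2)` (`|t| ≤ 2` by S-H1), its damping, the energy bootstrap `Win.damped_bound`
(`|u_k| ≤ (25/24)·(k+1)` while `4k³ ≤ d`) and the Hermite layer `Win.window_row_core`
(`|H_{d−j}(y)|·(2d)^{j/2} ≤ (6/5)(j−1)|H_d(y)|`-shaped row inequality for `3 ≤ i = j − 2`, `4i³ ≤ d`).  RH-FREE, ξ-free.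
Verbatim port of HOME `rh-jensen-theory/JensenTargets.lean` v4.6 §8.9 (first half) (cell rh-jensen, D-0040; D-0064(4)); supports the
route item `JensenPolynomials.HermiteCriticalRatioWindow`.  Nothing here bears on the zeros of `ζ`. -/

noncomputable section
set_option linter.dupNamespace false

open Polynomial Finset
open scoped Nat

namespace Summit.RiemannHypothesis.RiemannHypothesis.Theorems.JensenPolynomials

open Literature.NumberTheory.LFunctions

namespace Win



/-- Energy of two consecutive terms for the recurrence with parameter `t`. -/
def energy (t a b : ℝ) : ℝ := a ^ 2 + b ^ 2 - t * a * b

/-- The energy is symmetric in its two arguments. -/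
lemma energy_symm (t a b : ℝ) : energy t a b = energy t b a := by unfold energy; ring

/-- Completing the square in the energy. -/
lemma energy_eq (t a b : ℝ) : energy t a b = (a - t / 2 * b) ^ 2 + (1 - t ^ 2 / 4) * b ^ 2 := by
  unfold energy; ring

/-- `1 − t²/4 ≥ 0` for `|t| ≤ 2`. -/
lemma four_sub_sq_nonneg {t : ℝ} (ht : |t| ≤ 2) : 0 ≤ 1 - t ^ 2 / 4 := by
  have h1 : t ^ 2 = |t| ^ 2 := (sq_abs t).symm
  nlinarith [abs_nonneg t, ht, h1]

/-- The completed square is bounded by the energy (`|t| ≤ 2`). -/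
lemma sq_le_energy {t : ℝ} (ht : |t| ≤ 2) (a b : ℝ) : (a - t / 2 * b) ^ 2 ≤ energy t a b := by
  rw [energy_eq]
  nlinarith [four_sub_sq_nonneg ht, sq_nonneg b, mul_nonneg (four_sub_sq_nonneg ht) (sq_nonneg b)]

/-- Symmetric form of `sq_le_energy`. -/
lemma sq_le_energy' {t : ℝ} (ht : |t| ≤ 2) (a b : ℝ) : (t / 2 * a - b) ^ 2 ≤ energy t a b := by
  rw [energy_symm, show (t / 2 * a - b) ^ 2 = (b - t / 2 * a) ^ 2 by ring]
  exact sq_le_energy ht b a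

/-- The bound functions of the bootstrap (`C = 25/24`). -/
def bndA (d : ℝ) (k : ℕ) : ℝ := 1 + 25 / 24 * (((k : ℝ) - 1) * k * (k + 2)) / (12 * d)
/-- Second bootstrap majorant `B_k(d) = 1 + (25/24)·k(k+1)(k+2)/(3d)`. -/
def bndB (d : ℝ) (k : ℕ) : ℝ := 1 + 25 / 24 * ((k : ℝ) * (k + 1) * (k + 2)) / (3 * d)

/-- One-step recursion for `bndA`. -/
lemma bndA_succ (d : ℝ) (hd : d ≠ 0) (k : ℕ) :
    ((k : ℝ) + 2) * bndA d (k + 1) = bndB d k + ((k : ℝ) + 1) * bndA d k := by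
  unfold bndA bndB; push_cast; field_simp; ring

/-- One-step recursion for `bndB`. -/
lemma bndB_succ (d : ℝ) (hd : d ≠ 0) (k : ℕ) :
    bndB d (k + 1) = bndB d k + 25 / 24 * (((k : ℝ) + 1) * ((k : ℝ) + 2)) / d := by
  unfold bndB; push_cast; field_simp; ring

/-- `bndB d k > 0` for `d > 0`. -/
lemma bndB_pos {d : ℝ} (hd : 0 < d) (k : ℕ) : 0 < bndB d k := by
  unfold bndB; positivity

/-- `bndA d k ≤ 25/24` inside the window `4k³ ≤ d`. -/
lemma bndA_le_C {d : ℝ} (hd : 0 < d) {k : ℕ} (hk : 4 * (k : ℝ) ^ 3 ≤ d) : bndA d k ≤ 25 / 24 := by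
  unfold bndA
  have hk0 : (0 : ℝ) ≤ k := Nat.cast_nonneg k
  -- 25 (k-1) k (k+2) ≤ 48 k³ ≤ 12 d
  have hq : (0 : ℝ) ≤ 23 * (k : ℝ) ^ 2 - 25 * k + 50 := by nlinarith [sq_nonneg ((k : ℝ) - 1)]
  have h1 : 25 * (((k : ℝ) - 1) * k * (k + 2)) ≤ 48 * (k : ℝ) ^ 3 := by
    nlinarith [mul_nonneg hk0 hq]
  have h3 : 25 / 24 * (((k : ℝ) - 1) * k * (k + 2)) / (12 * d) ≤ 1 / 24 := by
    rw [div_le_iff₀ (by positivity)]; nlinarith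
  linarith

/-- THE BOOTSTRAP. `u 0 = 1`, `u 1 = t`, `u (i+2) = t·u (i+1) − u i + (i+2)/d · u i` for `i + 2 ≤ N`;
then on the window `4k³ ≤ d` (and `k + 1 ≤ N`): `|u k| ≤ (k+1)·A_k` and `E_{k+1} ≤ B_k²`. -/
theorem damped_bound {t d : ℝ} (ht : |t| ≤ 2) (hd : 0 < d) (N : ℕ) (u : ℕ → ℝ) (h0 : u 0 = 1)
    (h1 : u 1 = t)
    (hrec : ∀ i : ℕ, i + 2 ≤ N → u (i + 2) = t * u (i + 1) - u i + ((i : ℝ) + 2) / d * u i) :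
    ∀ k : ℕ, k + 1 ≤ N → 4 * (k : ℝ) ^ 3 ≤ d →
      |u k| ≤ ((k : ℝ) + 1) * bndA d k ∧ energy t (u (k + 1)) (u k) ≤ bndB d k ^ 2 := by
  intro k
  induction k with
  | zero =>
    intro _ _
    refine ⟨?_, ?_⟩
    · simp [h0, bndA]
    · have hE1 : energy t (u (0 + 1)) (u 0) = 1 := by rw [h0, show 0 + 1 = 1 from rfl, h1]; unfold energy; ring
      have hB0 : bndB d 0 = 1 := by unfold bndB; simp
      rw [hE1, hB0]; norm_num
  | succ k ih =>
    intro hN hk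
    have hk0 : (0 : ℝ) ≤ k := Nat.cast_nonneg k
    have hkR : 4 * (k : ℝ) ^ 3 ≤ d := by
      push_cast at hk
      have : (k : ℝ) ^ 3 ≤ ((k : ℝ) + 1) ^ 3 := by nlinarith [sq_nonneg (k : ℝ), hk0]
      linarith
    obtain ⟨hu, hE⟩ := ih (by omega) hkR
    have hdne : d ≠ 0 := hd.ne'
    have hBpos := bndB_pos hd k
    -- |u k| ≤ C (k+1)
    have huC : |u k| ≤ 25 / 24 * ((k : ℝ) + 1) := by
      have := bndA_le_C hd hkR
      calc |u k| ≤ ((k : ℝ) + 1) * bndA d k := hu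
        _ ≤ ((k : ℝ) + 1) * (25 / 24) := by gcongr
        _ = _ := by ring
    -- the two completed squares
    have hg1 : |u (k + 1) - t / 2 * u k| ≤ bndB d k :=
      abs_le_of_sq_le_sq (by nlinarith [sq_le_energy ht (u (k + 1)) (u k)]) hBpos.le
    have hg2 : |t / 2 * u (k + 1) - u k| ≤ bndB d k :=
      abs_le_of_sq_le_sq (by nlinarith [sq_le_energy' ht (u (k + 1)) (u k)]) hBpos.le
    refine ⟨?_, ?_⟩
    · -- |u (k+1)| ≤ B_k + |u k| ≤ B_k + (k+1) A_k = (k+2) A_{k+1}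
      have ht2 : |t / 2| ≤ 1 := by rw [abs_div, abs_two]; linarith
      have h3 : |u (k + 1)| ≤ |u (k + 1) - t / 2 * u k| + |t / 2| * |u k| := by
        rw [← abs_mul]
        calc |u (k + 1)| = |(u (k + 1) - t / 2 * u k) + t / 2 * u k| := by ring_nf
          _ ≤ _ := abs_add_le _ _
      have h4 : |t / 2| * |u k| ≤ |u k| := by
        calc |t / 2| * |u k| ≤ 1 * |u k| := by gcongr
          _ = |u k| := one_mul _
      push_cast
      rw [show (k : ℝ) + 1 + 1 = (k : ℝ) + 2 by ring, bndA_succ d hdne k]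
      linarith
    · -- E_{k+2} = E_{k+1} + 2 f g + f² ≤ (B_k + ph)² = B_{k+1}²
      have hr := hrec k (by omega)
      set f : ℝ := ((k : ℝ) + 2) / d * u k with hf
      set g : ℝ := t / 2 * u (k + 1) - u k with hg
      have hexp : energy t (u (k + 2)) (u (k + 1)) = energy t (u (k + 1)) (u k) + 2 * f * g + f ^ 2 := by
        rw [show k + 1 + 1 = k + 2 from rfl, hr]; unfold energy; rw [hf, hg]; ring
      set ph : ℝ := 25 / 24 * (((k : ℝ) + 1) * ((k : ℝ) + 2)) / d with hph
      have hfph : |f| ≤ ph := by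
        rw [hf, hph, abs_mul, abs_div, abs_of_pos hd, abs_of_nonneg (by positivity : (0:ℝ) ≤ (k:ℝ) + 2)]
        rw [div_mul_eq_mul_div, le_div_iff₀ hd, div_mul_cancel₀ _ hdne]
        nlinarith
      have hph0 : 0 ≤ ph := by rw [hph]; positivity
      have hB1 : bndB d (k + 1) = bndB d k + ph := by rw [hph]; exact bndB_succ d hdne k
      rw [show k + 1 + 1 = k + 2 from rfl, hexp, hB1]
      have hfg : f * g ≤ ph * bndB d k := by
        calc f * g ≤ |f * g| := le_abs_self _
          _ = |f| * |g| := abs_mul _ _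
          _ ≤ ph * bndB d k := by gcongr
      have hf2 : f ^ 2 ≤ ph ^ 2 := by
        calc f ^ 2 = |f| ^ 2 := (sq_abs f).symm
          _ ≤ ph ^ 2 := by gcongr
      nlinarith

/-- Weierstrass product inequality: `1 − Σ yₗ ≤ Π (1 − yₗ)` for `0 ≤ yₗ ≤ 1`. -/
theorem one_sub_sum_le_prod (y : ℕ → ℝ) (n : ℕ) (h0 : ∀ l < n, 0 ≤ y l) (h1 : ∀ l < n, y l ≤ 1) :
    1 - ∑ l ∈ range n, y l ≤ ∏ l ∈ range n, (1 - y l) := by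
  induction n with
  | zero => simp
  | succ n ih =>
    have ih' := ih (fun l hl => h0 l (by omega)) (fun l hl => h1 l (by omega))
    rw [sum_range_succ, prod_range_succ]
    have hs : 0 ≤ ∑ l ∈ range n, y l := sum_nonneg (fun l hl => h0 l (by simp at hl; omega))
    have hy0 := h0 n (by omega)
    have hy1 := h1 n (by omega)
    nlinarith [mul_le_mul_of_nonneg_right ih' (by linarith : (0:ℝ) ≤ 1 - y n)]


/-! ## Hermite layer: the window rows at the critical points. -/

section hermite

/-- `G_m(y) ≠ 0` at a zero `y` of `G_{m+1}` (interlacing, tree `gorzHermite_interlaces`). -/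
theorem eval_ne_zero_of_next_zero (m : ℕ) {y : ℝ} (hy : (gorzHermite (m + 1)).eval y = 0) :
    (gorzHermite m).eval y ≠ 0 := by
  obtain ⟨r, _, hQ, hsign⟩ := gorzHermite_interlaces m
  have : ∃ i, y = r i := by
    rw [hQ, eval_prod, Finset.prod_eq_zero_iff] at hy
    obtain ⟨i, _, hi⟩ := hy
    exact ⟨i, by simpa [sub_eq_zero] using hi⟩
  obtain ⟨i, rfl⟩ := this
  intro h0
  have h := hsign i
  rw [h0, mul_zero] at h
  exact lt_irrefl _ h

/-- The three-term recurrence of `gorzHermite`, evaluated. -/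
theorem eval_rec (n : ℕ) (y : ℝ) : (gorzHermite (n + 2)).eval y =
    y * (gorzHermite (n + 1)).eval y - 2 * ((n : ℝ) + 1) * (gorzHermite n).eval y := by
  rw [gorzHermite_add_two, eval_sub, eval_mul, eval_X, eval_mul, eval_C]

/-- `Σ_{l<i} (l+2) = i(i+3)/2`. -/
lemma sum_range_add_two (i : ℕ) : ∑ l ∈ range i, ((l : ℝ) + 2) = (i : ℝ) * (i + 3) / 2 := by
  induction i with
  | zero => simp
  | succ i ih => rw [sum_range_succ, ih]; push_cast; ring

/-- CORE (indices without subtraction): `m = d − 2`, `i = j − 2`; at a zero `y` of `G_{m+1}` with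
`|y| ≤ 2√(2(m+2))`, on the window `3 ≤ i`, `4i³ ≤ m+2`:
`|G_{m−i}(y)|·(√(2(m+2)))^{i+2} ≤ (6/5)(i+1)|G_{m+2}(y)|`. -/
theorem window_row_core (m i : ℕ) (y : ℝ) (hi : 3 ≤ i) (hw : 4 * i ^ 3 ≤ m + 2)
    (hy : (gorzHermite (m + 1)).eval y = 0) (hy2 : |y| ≤ 2 * Real.sqrt (2 * ((m : ℝ) + 2))) :
    |(gorzHermite (m - i)).eval y| * Real.sqrt (2 * ((m : ℝ) + 2)) ^ (i + 2) ≤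
      6 / 5 * ((i : ℝ) + 1) * |(gorzHermite (m + 2)).eval y| := by
  -- sizes
  have h9 : 9 * i ≤ i ^ 3 := by
    have : 3 * 3 ≤ i * i := Nat.mul_le_mul hi hi
    calc 9 * i = 3 * 3 * i := by ring
      _ ≤ i * i * i := Nat.mul_le_mul_right i this
      _ = i ^ 3 := by ring
  have him : i + 3 ≤ m := by omega
  set D : ℝ := (m : ℝ) + 2 with hDdef
  have hD : 0 < D := by positivity
  set r : ℝ := Real.sqrt (2 * ((m : ℝ) + 2)) with hrdef
  have hr2 : r ^ 2 = 2 * D := by rw [hrdef, Real.sq_sqrt (by positivity)]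
  have hr0 : 0 < r := by rw [hrdef]; positivity
  have hmR : (m : ℝ) = r ^ 2 / 2 - 2 := by rw [hr2, hDdef]; ring
  -- the sequence
  set a : ℕ → ℝ := fun n => (gorzHermite n).eval y with hadef
  have ham : a m ≠ 0 := eval_ne_zero_of_next_zero m hy
  have harec : ∀ n, a (n + 2) = y * a (n + 1) - 2 * ((n : ℝ) + 1) * a n := fun n => eval_rec n y
  set w : ℕ → ℝ := fun k => ∏ l ∈ range k, (((m : ℝ) - l) / D) with hwdef
  set u : ℕ → ℝ := fun k => a (m - k) * r ^ k * w k / a m with hudef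
  set t : ℝ := y / r with htdef
  have ht : |t| ≤ 2 := by
    rw [htdef, abs_div, abs_of_pos hr0, div_le_iff₀ hr0]; exact hy2
  have hu0 : u 0 = 1 := by simp [hudef, hwdef, ham]
  have hu1 : u 1 = t := by
    obtain ⟨m', rfl⟩ : ∃ m', m = m' + 1 := ⟨m - 1, by omega⟩
    have h := harec m'
    have hy' : a (m' + 1 + 1) = 0 := hy
    rw [show m' + 2 = m' + 1 + 1 from rfl, hy'] at h
    -- a m' = y a (m'+1) / (2(m'+1))
    have hm1 : (0 : ℝ) < 2 * ((m' : ℝ) + 1) := by positivity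
    have ha' : a m' = y * a (m' + 1) / (2 * ((m' : ℝ) + 1)) := by
      field_simp; linarith
    simp only [hudef, hwdef, show m' + 1 - 1 = m' by omega, prod_range_one, pow_one, Nat.cast_zero, sub_zero]
    rw [ha', htdef]
    have hm'R : (m' : ℝ) = r ^ 2 / 2 - 3 := by push_cast at hmR; linarith
    have hD' : ((m' + 1 : ℕ) : ℝ) + 2 ≠ 0 := by positivity
    rw [hDdef]
    field_simp
    push_cast
    rw [hm'R]
    ring
  have hurec : ∀ k : ℕ, k + 2 ≤ m → u (k + 2) = t * u (k + 1) - u k + ((k : ℝ) + 2) / D * u k := by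
    intro k hk
    obtain ⟨n, hn⟩ : ∃ n, n + k + 2 = m := ⟨m - k - 2, by omega⟩
    have e0 : m - (k + 2) = n := by omega
    have e1 : m - (k + 1) = n + 1 := by omega
    have e2 : m - k = n + 2 := by omega
    have hnR : (n : ℝ) = r ^ 2 / 2 - 4 - k := by
      have := congrArg (Nat.cast : ℕ → ℝ) hn; push_cast at this; linarith
    have hw1 : w (k + 1) = w k * (((m : ℝ) - k) / D) := by
      simp only [hwdef, prod_range_succ]
    have hw2 : w (k + 2) = w k * (((m : ℝ) - k) / D) * (((m : ℝ) - (k + 1)) / D) := by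
      simp only [hwdef, prod_range_succ, Nat.cast_add, Nat.cast_one]
    have hn1 : (0 : ℝ) < 2 * ((n : ℝ) + 1) := by positivity
    have ha : a n = (y * a (n + 1) - a (n + 2)) / (2 * ((n : ℝ) + 1)) := by
      rw [harec n]; field_simp; ring
    have hD' : (m : ℝ) + 2 ≠ 0 := by positivity
    simp only [hudef]
    rw [e0, e1, e2, hw1, hw2, ha, htdef, hDdef]
    field_simp
    rw [hnR, hmR]
    ring
  -- the bootstrap on the window
  have hwin : 4 * (i : ℝ) ^ 3 ≤ D := by rw [hDdef]; exact_mod_cast hw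
  obtain ⟨hui, -⟩ := damped_bound ht hD m u hu0 hu1 hurec i (by omega) hwin
  have hA := bndA_le_C hD hwin
  have hui' : |u i| ≤ 25 / 24 * ((i : ℝ) + 1) := by
    calc |u i| ≤ ((i : ℝ) + 1) * bndA D i := hui
      _ ≤ ((i : ℝ) + 1) * (25 / 24) := by gcongr
      _ = _ := by ring
  -- the prefactor: w i ≥ 11/12
  have hwi : 11 / 12 ≤ w i := by
    have hW := one_sub_sum_le_prod (fun l => ((l : ℝ) + 2) / D) i
      (fun l _ => by positivity)
      (fun l hl => by
        rw [div_le_one hD, hDdef]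
        have : (l : ℝ) < i := by exact_mod_cast hl
        have : (i : ℝ) + 3 ≤ m := by exact_mod_cast him
        linarith)
    have hprod : ∏ l ∈ range i, (1 - ((l : ℝ) + 2) / D) = w i := by
      rw [hwdef]; refine prod_congr rfl (fun l _ => ?_); rw [hDdef]; field_simp; ring
    rw [hprod, ← sum_div, sum_range_add_two] at hW
    -- i(i+3)/2 / D ≤ 1/12  ⇐  6 i (i+3) ≤ D ⇐ 4 i³ ≤ D, i ≥ 3
    have hi3 : (3 : ℝ) ≤ i := by exact_mod_cast hi
    have h6 : 6 * ((i : ℝ) * (i + 3)) ≤ 4 * (i : ℝ) ^ 3 := by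
      have : (0 : ℝ) ≤ 2 * i * (2 * i + 3) * ((i : ℝ) - 3) :=
        mul_nonneg (by positivity) (sub_nonneg.2 hi3)
      nlinarith [this]
    have : (i : ℝ) * (i + 3) / 2 / D ≤ 1 / 12 := by
      rw [div_div, div_le_div_iff₀ (by positivity) (by norm_num)]; nlinarith
    linarith
  have hwpos : 0 < w i := by linarith
  -- |a (m-i)| r^i w i = |u i| |a m|
  have hkey : |a (m - i)| * r ^ i * w i = |u i| * |a m| := by
    simp only [hudef]
    rw [abs_div, abs_mul, abs_mul, abs_of_pos (pow_pos hr0 i), abs_of_pos hwpos]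
    field_simp
  -- |a m| = |a (m+2)| / (2(m+1))
  have ham2 : |a m| * (2 * ((m : ℝ) + 1)) = |a (m + 2)| := by
    have h := harec m
    have hy' : a (m + 1) = 0 := hy
    rw [hy', mul_zero, zero_sub] at h
    rw [h, abs_neg, abs_mul, abs_of_pos (by positivity : (0 : ℝ) < 2 * ((m : ℝ) + 1))]; ring
  -- assemble: |a(m-i)| r^(i+2) = |u i| |a m| r² / w i ≤ (25/24)(i+1) (12/11) |a m| 2D ≤ (6/5)(i+1)|a(m+2)|
  have hm106 : (106 : ℝ) ≤ m := by exact_mod_cast (show 106 ≤ m by omega)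
  have habs : 0 ≤ |a m| := abs_nonneg _
  calc |a (m - i)| * r ^ (i + 2)
      = (|a (m - i)| * r ^ i * w i) * r ^ 2 / w i := by field_simp; ring
    _ = |u i| * |a m| * (2 * D) / w i := by rw [hkey, hr2]
    _ ≤ (25 / 24 * ((i : ℝ) + 1)) * |a m| * (2 * D) / (11 / 12) := by
        have hnum : |u i| * |a m| * (2 * D) ≤ (25 / 24 * ((i : ℝ) + 1)) * |a m| * (2 * D) := by gcongr
        calc |u i| * |a m| * (2 * D) / w i ≤ (25 / 24 * ((i : ℝ) + 1)) * |a m| * (2 * D) / w i := by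
              gcongr
          _ ≤ _ := by
              apply div_le_div_of_nonneg_left (by positivity) (by norm_num) hwi
    _ = (25 / 22) * ((i : ℝ) + 1) * D / ((m : ℝ) + 1) * (|a m| * (2 * ((m : ℝ) + 1))) := by
        field_simp; ring
    _ = (25 / 22) * ((i : ℝ) + 1) * D / ((m : ℝ) + 1) * |a (m + 2)| := by rw [ham2]
    _ ≤ 6 / 5 * ((i : ℝ) + 1) * |a (m + 2)| := by
        have hcoef : (25 / 22) * D / ((m : ℝ) + 1) ≤ 6 / 5 := by
          rw [div_le_iff₀ (by positivity), hDdef]; nlinarith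
        have := mul_le_mul_of_nonneg_right hcoef (by positivity : (0 : ℝ) ≤ ((i : ℝ) + 1) * |a (m + 2)|)
        calc (25 / 22) * ((i : ℝ) + 1) * D / ((m : ℝ) + 1) * |a (m + 2)|
            = (25 / 22) * D / ((m : ℝ) + 1) * (((i : ℝ) + 1) * |a (m + 2)|) := by ring
          _ ≤ 6 / 5 * (((i : ℝ) + 1) * |a (m + 2)|) := this
          _ = _ := by ring

end hermite


end Win
end Summit.RiemannHypothesis.RiemannHypothesis.Theorems.JensenPolynomials

end
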